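import Literature.AnabelianGeometry.AbsoluteAnabelian.FreeProcyclicStructure
import Literature.AnabelianGeometry.AbsoluteAnabelian.AbsTopIII.GeometricCyclotome
import HarnessLib

/-!
# `I_x ≅ Ẑ` in the cell's coefficients `ZHatCoeff` (adapter)

S. Mochizuki, *Topics in Absolute Anabelian Geometry III* [AbsTopIII], Prop 1.4 (i) p. 31 (lit key
`paper:url-5493eb38cbb7`; bib key `MochizukiAbsTopIII2015`); [AbsTopII] Prop 1.3 (i) p. 11.  This
proof-only file (no definitions) is the generic ADAPTER between the structure theorem for free
procyclic compact groups (`FreeProcyclicStructure`, abc-iut-L4-t6: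
`IsFreeProcyclic G ⇒ Additive G ≃ₜ+ ULift (∏_p ℤ_p)`) and statements over the cyclotome
coefficient ring `AbsTopIII.ZHatCoeff.{u} = ULift.{u} (∀ p : Nat.Primes, ℤ_[p])` of [AbsTopIII] §1
(an `abbrev`, so the adapter is definitional):

* `FundamentalExtension.IsFreeProcyclic.exists_continuousAddEquiv_zhat` /
  `nonempty_continuousAddEquiv_zhat` — the consumer shape requested by abc-iut-L4-t1 (INBOX
  2026-08-25T23:56:13Z), verbatim, for an ARBITRARY compact Hausdorff totally disconnected `G`;
* the closed-subgroup form (an inertia group `I ⊆ Π` closed in a profinite `Π`);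
* the same for the `Σ = Primes` case of [AbsTopII] Prop 1.3 (i)'s predicate
  `AbsTopII.IsFreeProSigmaCyclic Set.univ`.

The application to cyclotome presentations and [AbsTopIII] Thm 1.9 (b) (natural form) is
abc-iut-L4-t1's (`AbsTopIII.CuspidalSynchronizationHolds`), not repeated here.
-/

namespace Literature.AnabelianGeometry.AbsoluteAnabelian

universe u

section Adapter

variable {G : Type u} [Group G] [TopologicalSpace G] [IsTopologicalGroup G] [CompactSpace G]
  [T2Space G] [TotallyDisconnectedSpace G]

/-- **`≅ Ẑ` in the cell's coefficients**: a free procyclic compact Hausdorff totally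
disconnected group (`IsFreeProcyclic`: dense cyclic subgroup, an open subgroup of every positive
index — the interface predicate for [AbsTopIII] Prop 1.4 (i) p. 31 "the inertia group `I_x` of
`x` in `Δ_U` is naturally isomorphic to `Ẑ(1)`") is, additively, `≃ₜ+ ZHatCoeff = ULift (∏_p ℤ_p)`,
with the topological generator going to `1`.
[cite: MochizukiAbsTopIII2015, Prop 1.4 (i) p.31] -/
theorem FundamentalExtension.IsFreeProcyclic.exists_continuousAddEquiv_zhat
    (h : FundamentalExtension.IsFreeProcyclic G) :
    ∃ e : Additive G ≃ₜ+ AbsTopIII.ZHatCoeff.{u},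
      ∃ g : G, Dense (Subgroup.zpowers g : Set G) ∧ e (Additive.ofMul g) = ULift.up 1 :=
  h.exists_continuousAddEquiv_ulift_padicProd

/-- The consumer shape of abc-iut-L4-t1 ([AbsTopIII] §1 synchronization files), verbatim:
`IsFreeProcyclic G → Nonempty (Additive G ≃ₜ+ ZHatCoeff)` for compact Hausdorff totally
disconnected `G`. [cite: MochizukiAbsTopIII2015, Prop 1.4 (i) p.31] -/
theorem FundamentalExtension.IsFreeProcyclic.nonempty_continuousAddEquiv_zhat
    (h : FundamentalExtension.IsFreeProcyclic G) :
    Nonempty (Additive G ≃ₜ+ AbsTopIII.ZHatCoeff.{u}) := by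
  obtain ⟨e, -⟩ := h.exists_continuousAddEquiv_zhat
  exact ⟨e⟩

/-- Closed-subgroup form: a closed subgroup `I` of a compact Hausdorff totally disconnected group
(e.g. an inertia group `I_x ⊆ Π` of a profinite `Π`) with `IsFreeProcyclic I` is, additively,
`≃ₜ+ ZHatCoeff`. [cite: MochizukiAbsTopIII2015, Prop 1.4 (i) p.31] -/
theorem FundamentalExtension.IsFreeProcyclic.nonempty_continuousAddEquiv_zhat_of_isClosed
    {I : Subgroup G} (hI : IsClosed (I : Set G)) (h : FundamentalExtension.IsFreeProcyclic I) :
    Nonempty (Additive I ≃ₜ+ AbsTopIII.ZHatCoeff.{u}) := by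
  haveI : CompactSpace I := isCompact_iff_compactSpace.mp hI.isCompact
  exact h.nonempty_continuousAddEquiv_zhat

/-- The same for the `Σ = Primes` form of [AbsTopII] Prop 1.3 (i)'s predicate
(`AbsTopII.IsFreeProSigmaCyclic Set.univ`). [cite: MochizukiAbsTopII2013, Prop 1.3 (i) p.11] -/
theorem AbsTopII.IsFreeProSigmaCyclic.nonempty_continuousAddEquiv_zhat
    (h : AbsTopII.IsFreeProSigmaCyclic Set.univ G) :
    Nonempty (Additive G ≃ₜ+ AbsTopIII.ZHatCoeff.{u}) :=
  FundamentalExtension.IsFreeProcyclic.nonempty_continuousAddEquiv_zhat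
    ⟨h.exists_dense_zpowers, fun n hn =>
      (h.isOpen_index_iff n).mpr ⟨hn, fun _ _ _ => Set.mem_univ _⟩⟩

end Adapter

end Literature.AnabelianGeometry.AbsoluteAnabelian
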